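import Literature.NumberTheory.Rogawski1990.CurveThetaCohFinComponentUnique
import Literature.NumberTheory.Rogawski1990.CurveCohomologicalSpectrum
import Literature.NumberTheory.Automorphic.UnitaryCurveCohCotangentFormsConjRep
import Summits.HodgeConjecture.HodgeConjecture.Theorems.HLiu418ChiSplittingMirror
import Summits.HodgeConjecture.HodgeConjecture.Theorems.HLiu418E1pOfE1
import HarnessLib

/-!
# Crux `HLiu418`, floor 0, programme P5 — the θ-RESTRICTED LETTER E1θ₂ ([Liu2021, Prop. D.4 (1)] verbatim, ★ `Rogawski1990/CurveThetaCohFinComponentUnique`):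
# (§1) it is WEAKER than E1′₂ and than E1₂; (§2) its antiholomorphic half FOLLOWS from its holomorphic half

Cell hodgecm-mathlib (D-0151), crux item `HLiu418` = stmt-HodgeConjecture-24832, parent line `Cruxes/HLiu418/Lines/F0_AlbCm.lean` (packaged stub
`stub_S1_facts`); seat F0P5-p02 (g4).  THEOREMS ONLY (no definition, no instance, no notation, no named fact, no `sorry`); `--supports stmt-HodgeConjecture-24832
--as helper`, count-neutral.  HC_CM is proved only modulo the 7 printed citations (+ declared floor-0 debt) until rung 0 closes; nothing printed is discharged here.

* §1 `curveThetaCohFinComponentUnique_hol_of_curveCohFinComponentUnique_hol` ∕ `…_antihol_of_…_antihol` (restriction: the ω-side data are not used) and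
  `curveThetaCohFinComponentUnique_hol_of_curveMultiplicityLeOne` ∕ `…_antihol_of_curveMultiplicityLeOne` (through ★ `E1pOfE1`): the books' row
  «E1 ↦ E1θ» is a WEAKENING.
* §2 **`curveThetaCohFinComponentUnique_antihol_of_hol : _hol → _antihol`** — complex conjugation `P ↦ P̄` exchanges the Hodge types
  (★ `isAntiholCotangentAt₂_iff_conj`), carries the finite component to `σ̄ = repConj σ` (★ `hasFinComponent_conj_repConj`; irreducible and smooth, ★
  `isIrreducible_repConj_iff` ∕ `isSmooth_repConj_iff`), and the theta carrier to its CONJUGATE PARTNER `ω(λᶜ, ⟨−a⟩, χ̄)` (★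
  `DoubledWeilMirror.exists_conjPartner_omegaAtLine_neg`, [Liu2021, Lem. D.1 (2)], F0P5-p04 (g3) ROAD U); the holomorphic letter at the conjugate data gives
  `P̄ = P̄′`, hence `P = P′` (★ `DiscreteAutomorphicRep.conj_conj`).  Template: ★ `E3AntiholOfHol` (the signed letters) minus the admissibility flip.
⇒ in the parent's books ONE letter `curveThetaCohFinComponentUnique_hol` serves both (L10) and (L01).

References: [Liu2021] Y. Liu, Camb. J. Math. 9 (2021), App. D Prop. D.4 (1) and proof (p. 130–131), Lem. D.1 (2), Rem. D.5.  [Rogawski1990] J. Rogawski,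
Ann. of Math. Stud. 123, §11.  [BorelWallach2000] VII 2.10.  [Li1992] J.-S. Li, J. reine angew. Math. 428 (1992), p. 181.
-/

set_option autoImplicit false
-- the mandated namespace has the single-problem summit's repeated segment (`HodgeConjecture.HodgeConjecture`)
set_option linter.dupNamespace false

noncomputable section

open NumberField NumberField.InfinitePlace MeasureTheory IsDedekindDomain
open scoped Matrix ComplexOrder
open Literature.NumberTheory.Automorphic Literature.NumberTheory.Automorphic.UnitaryGroup
open Literature.NumberTheory.Automorphic.UnitaryGroup.CotangentForms (toQuotFun hasFinComponent_conj_repConj)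
open Literature.NumberTheory.Automorphic.UnitaryCurveForms
open Literature.NumberTheory.Automorphic.ConjVec
open Literature.NumberTheory.Automorphic.Liu2021 Literature.NumberTheory.Automorphic.Liu2021.Def411WeilCarriers
open Literature.NumberTheory.Automorphic.Liu2021.Def411WeilCarriersDoubling
open Literature.NumberTheory.GaloisRepresentations Literature.NumberTheory.Automorphic.IdeleClassGroup
open Literature.NumberTheory.GelbartRogawski1991 Literature.NumberTheory.GelbartRogawski1991.UnitaryDualPair
open Literature.RepresentationTheory.Liu2021 Literature.RepresentationTheory.HarrisKudlaSweet1996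
open Literature.NumberTheory.Rogawski1990 (curveThetaCohFinComponentUnique_hol curveThetaCohFinComponentUnique_antihol
  curveCohFinComponentUnique_hol curveCohFinComponentUnique_antihol curveMultiplicityLeOne)
open Summit.HodgeConjecture.HodgeConjecture.Cruxes.HLiu418.DoubledWeilMirror (exists_conjPartner_omegaAtLine_neg)

namespace Summit.HodgeConjecture.HodgeConjecture.Cruxes.HLiu418.E1Theta

/-! ## §1 E1θ₂ is weaker than E1′₂ (and than E1₂) -/

/-- **E1′hol₂ → E1θhol₂** by restriction (the ω-side data `e₁, λ, a, χ, j` are not used). [cite: Liu2021, App. D Prop. D.4 (1)] -/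
theorem curveThetaCohFinComponentUnique_hol_of_curveCohFinComponentUnique_hol (h : curveCohFinComponentUnique_hol) :
    curveThetaCohFinComponentUnique_hol := by
  intro L _ _ _ ι H dV hdV hdV0 t ht g hg hsig hpos h4 𝔣 μ _ n' e₁ lam hlam hw a χ W _ _ σ hirr hsm j hj P P' hP hP' hPσ hP'σ
  exact h L ι H dV hdV hdV0 t ht g hg hsig hpos h4 𝔣 μ W σ hirr hsm P P' hP hP' hPσ hP'σ

/-- **E1′antihol₂ → E1θantihol₂** by restriction. [cite: Liu2021, App. D Prop. D.4 (1)] -/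
theorem curveThetaCohFinComponentUnique_antihol_of_curveCohFinComponentUnique_antihol (h : curveCohFinComponentUnique_antihol) :
    curveThetaCohFinComponentUnique_antihol := by
  intro L _ _ _ ι H dV hdV hdV0 t ht g hg hsig hpos h4 𝔣 μ _ n' e₁ lam hlam hw a χ W _ _ σ hirr hsm j hj P P' hP hP' hPσ hP'σ
  exact h L ι H dV hdV hdV0 t ht g hg hsig hpos h4 𝔣 μ W σ hirr hsm P P' hP hP' hPσ hP'σ

/-- **E1₂ → E1θhol₂** (through ★ `E1pOfE1.curveCohFinComponentUnique_hol_of_curveMultiplicityLeOne`): the books' swap E1 ↦ E1θ is a weakening.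
[cite: Liu2021, App. D Prop. D.4 (1) and proof (p. 130–131)] [cite: Rogawski1990, §11.1 Prop. 11.1.1; Thm. 11.5.1] -/
theorem curveThetaCohFinComponentUnique_hol_of_curveMultiplicityLeOne (h : curveMultiplicityLeOne) : curveThetaCohFinComponentUnique_hol :=
  curveThetaCohFinComponentUnique_hol_of_curveCohFinComponentUnique_hol (E1pOfE1.curveCohFinComponentUnique_hol_of_curveMultiplicityLeOne h)

/-- **E1₂ → E1θantihol₂** (through ★ `E1pOfE1.curveCohFinComponentUnique_antihol_of_curveMultiplicityLeOne`).
[cite: Liu2021, App. D Prop. D.4 (1) and proof (p. 130–131)] [cite: Rogawski1990, §11.1 Prop. 11.1.1; Thm. 11.5.1] -/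
theorem curveThetaCohFinComponentUnique_antihol_of_curveMultiplicityLeOne (h : curveMultiplicityLeOne) : curveThetaCohFinComponentUnique_antihol :=
  curveThetaCohFinComponentUnique_antihol_of_curveCohFinComponentUnique_antihol
    (E1pOfE1.curveCohFinComponentUnique_antihol_of_curveMultiplicityLeOne h)

/-! ## §2 The antiholomorphic half follows from the holomorphic half -/

set_option maxHeartbeats 4000000 in
-- (two instances of the E1θ letter telescope and the conjugate-partner telescope are elaborated and matched; as in ★ `E3AntiholOfHol`)
/-- **E1θantihol₂ ⟸ E1θhol₂, UNCONDITIONALLY.**  Given antiholomorphic data `(λ, a, χ, W, σ, j, P, P′)`: `P̄`, `P̄′` are holomorphic (★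
`isAntiholCotangentAt₂_iff_conj`) with finite component `σ̄ = repConj σ` (★ `hasFinComponent_conj_repConj`), irreducible and smooth; the conjugate partner
`J : ω(λ, ⟨a⟩, χ) → ω(λᶜ, ⟨−a⟩, χ̄)` (★ `exists_conjPartner_omegaAtLine_neg`, bijective, conjugate-linear, equivariant) makes `J ∘ j ∘ toConj⁻¹ : σ̄ → ω(λᶜ, ⟨−a⟩, χ̄) ∘
(finAdelicCongr …)⁻¹` a complex-linear injective intertwiner; the holomorphic letter there gives `P̄ = P̄′`, whence `P = P′` (★ `conj_conj`).
[cite: Liu2021, App. D Prop. D.4 (1) and proof (p. 130–131); Lem. D.1 (2) (l. 5231)] [cite: BorelWallach2000, VII 2.10] [cite: Li1992, p. 181] -/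
theorem curveThetaCohFinComponentUnique_antihol_of_hol (hE1 : curveThetaCohFinComponentUnique_hol) : curveThetaCohFinComponentUnique_antihol := by
  intro L _ _ _ ι H dV hdV hdV0 t ht g hg hsig hpos h4 𝔣 μ _ n' e₁ lam hlam hw a χ W _ _ σ hirr hsm j hj P P' hP hP' hPσ hP'σ
  -- the conjugate partner at `(λ, a, χ)`
  obtain ⟨lam', hlam', hw', -, J, hJb, hJ⟩ := exists_conjPartner_omegaAtLine_neg L e₁ dV hdV hdV0 lam hlam hw a χ
  -- the conjugate data: `P̄`, `P̄′` holomorphic with finite component `σ̄`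
  have hPc : P.conj.IsHolCotangentAt₂ (IsCMField.complexConj_ne_one L) (UnitaryGroup.complexConj_smul_infinitePlace L)
      (cmPlace L ι) 𝔣 := (isAntiholCotangentAt₂_iff_conj _ _ _ P 𝔣).mp hP
  have hP'c : P'.conj.IsHolCotangentAt₂ (IsCMField.complexConj_ne_one L) (UnitaryGroup.complexConj_smul_infinitePlace L)
      (cmPlace L ι) 𝔣 := (isAntiholCotangentAt₂_iff_conj _ _ _ P' 𝔣).mp hP'
  have hPσc : P.conj.HasFinComponent (repConj σ) := hasFinComponent_conj_repConj P hPσ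
  have hP'σc : P'.conj.HasFinComponent (repConj σ) := hasFinComponent_conj_repConj P' hP'σ
  have hirr' : (repConj σ).IsIrreducible := (isIrreducible_repConj_iff σ).mpr hirr
  have hsm' : (repConj σ).IsSmooth := (isSmooth_repConj_iff σ).mpr hsm
  -- the conjugate intertwiner `J ∘ j ∘ toConj⁻¹`, complex-linear and injective
  let j'ₗ := (J : _ →ₛₗ[starRingEnd ℂ] _).comp (j.toLinearMap.comp ((toConj (V := W)).symm : ConjVec W →ₛₗ[starRingEnd ℂ] W))
  have hj'ₗ : ∀ w : ConjVec W, j'ₗ w = J (j ((toConj (V := W)).symm w)) := fun _ => rfl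
  let j' := LinearMap.intertwiningMap_of_isIntertwiningMap (repConj σ)
    ((rhoVAtLine (↥(maximalRealSubfield L)) L (IsCMField.complexConj L) 2 e₁ (Matrix.diagonal dV)
        (complexConj_imagUnit L) (imagUnit_ne_zero L) (imagUnit_mul_self L) (realDiagonal_isSymm L dV hdV)
        (isUnit_det_realDiagonal L dV hdV hdV0) (realDiagonal_map L dV hdV).symm
        (fun a => isCompatible_chiSplittingLine L e₁ dV hdV hdV0 (toHeckeCharacter L lam')
          (isUnitary_toHeckeCharacter L lam') ((isOscillatorChar_toHeckeCharacter_iff lam').mpr hlam')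
          (TW (↥(maximalRealSubfield L)) a) (isSymm_TW (↥(maximalRealSubfield L)) a)
          (isUnit_det_TW (↥(maximalRealSubfield L)) a) (JW (↥(maximalRealSubfield L)) L a)
          (JW_eq (↥(maximalRealSubfield L)) L a)) (-a)
        ⟨(Units.map ((starRingEnd ℂ : ℂ →+* ℂ) : ℂ →* ℂ)).comp χ.1,
          isAutomorphicOneChar_unitsMap_comp_chi (IsCMField.complexConj L) χ _⟩).comp
      (finAdelicCongr (↥(maximalRealSubfield L)) L (IsCMField.complexConj L) g ht hg).symm.toMonoidHom)
    j'ₗ (fun k w => by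
      rw [hj'ₗ, hj'ₗ, repConj_apply, LinearEquiv.symm_apply_apply,
        Representation.IntertwiningMap.isIntertwining σ _ j k, MonoidHom.comp_apply, MonoidHom.comp_apply]
      exact hJ _ _)
  have hj'app : ∀ w : ConjVec W, j' w = J (j ((toConj (V := W)).symm w)) := fun _ => rfl
  have hj' : Function.Injective j' := fun w w' hww' => by
    rw [hj'app, hj'app] at hww'
    exact (toConj (V := W)).symm.injective (hj (hJb.1 hww'))
  -- the holomorphic letter at the conjugate data
  have key := hE1 L ι H dV hdV hdV0 t ht g hg hsig hpos h4 𝔣 μ e₁ lam' hlam' hw' (-a)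
    ⟨(Units.map ((starRingEnd ℂ : ℂ →+* ℂ) : ℂ →* ℂ)).comp χ.1,
      isAutomorphicOneChar_unitsMap_comp_chi (IsCMField.complexConj L) χ _⟩
    (ConjVec W) (repConj σ) hirr' hsm' j' hj' P.conj P'.conj hPc hP'c hPσc hP'σc
  rw [← DiscreteAutomorphicRep.conj_conj P, ← DiscreteAutomorphicRep.conj_conj P', key]

/-- The same as a bare implication between the two named facts, for by-name consumption. [cite: Liu2021, App. D Prop. D.4 (1)] -/
theorem curveThetaCohFinComponentUnique_hol_imp_antihol : curveThetaCohFinComponentUnique_hol → curveThetaCohFinComponentUnique_antihol :=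
  curveThetaCohFinComponentUnique_antihol_of_hol

end Summit.HodgeConjecture.HodgeConjecture.Cruxes.HLiu418.E1Theta

end
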